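import Mathlib
import Summits.Ventures.LatticeQCDFlow.TrivializingMaps.GradedSupBounds
import HarnessLib

/-!
# The order-`N` truncated Wilson generator is bounded on `SU(n)^E`, uniformly in the volume (`M_Z`)

HONEST FRAMING: exact (Metropolis-corrected) sampling algorithms for lattice gauge theory; figures
of merit are autocorrelation/cost numbers at stated couplings and volumes; no continuum-physics claim.
Finite periodic lattices `(ℤ/L)^d`; every constant below is independent of `L`.

M. Lüscher, CMP 293 (2010) 899–919 [Luscher2010Trivializing], §3.2 (flow `U̇_t = Z_t(U_t)U_t`,
`Z_t = -∑ₐ ∂^a_e S̃_t T^a`, eq. (3.2)/(3.6)) and §4.5(c) (the order-`N` truncation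
`S̃^{[N]}_t = ∑_{k≤N} t^k S̃^{(k)}`).  THEOREM L (`FlowLightCone.lean`, theory-1 GEN-17; THEORY-1.md §26)
bounds the light cone of a flow map `Φ` of a generator `Z` in terms of two volume-free constants: a
sup-Lipschitz modulus `K_Z` (open input `TruncatedGeneratorLipschitz`, §26.4) and a SUP BOUND `M_Z` of
`‖Z_t(ιU)_e‖_F` on the field manifold.  This file supplies `M_Z` for the generators of the samplers of
record — the colour gradient `linkGrad B S̃^{[N]}_t` of the truncated Casimir-graded flow action for
`β·S_W` — from THEOREM A (`abs_linkDeriv_gradedSk_le`, lean-2 `GradedSupBounds`):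

* `norm_linkGrad_le` — `‖linkGrad B f W e‖_F ≤ M · ∑ₐ ‖T^a‖_F` whenever `|∂^a_e f(W)| ≤ M` for all `a`;
* `abs_linkDeriv_truncFlowAction_smul_gradedSk_le` — for the β-scaled graded series
  `S̃^{(k)}_β := β^{k+1} S̃^{(k)}`: `|∂^a_e S̃^{[N]}_{β,t}(ιU)| ≤ ∑_{k≤N} |t|^k |β|^{k+1} N₀ θ₁^k`;
* `norm_linkGrad_truncFlowAction_smul_gradedSk_le` — **`M_Z`: `‖linkGrad B S̃^{[N]}_{β,t} (ιU) e‖_F ≤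
  (∑_{k≤N} |t|^k |β|^{k+1} N₀ θ₁^k) · ∑ₐ ‖T^a‖_F`** for every `U ∈ SU(n)^E`, link `e`, volume `L`
  (and the same for `-linkGrad`, the generator itself, `norm_neg`).

Constants: `d, n, B, N, t, β` only.  Nothing is claimed about the exact (untruncated) flow.  Authored by
the pub-lqcd theory-1 seat (cell lqcd-flow, FANOUT row 28, GEN-17; FANOUT-theory1 §20 row R-T1-81).
Tags: [ours] = venture work.
-/

noncomputable section

namespace Summit.Ventures.LatticeQCDFlow.TrivializingMaps

open scoped ComplexConjugate Matrix Matrix.Norms.Frobenius InnerProductSpace ContDiff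
open Literature.MathematicalPhysics.QuantumFieldTheory
open Literature.MathematicalPhysics.QuantumFieldTheory.Luscher2010

variable {d L n : ℕ} [NeZero L]

omit [NeZero L] in
/-- `‖∂f(W)(e)‖_F ≤ M ∑ₐ ‖T^a‖_F` if every colour component is `≤ M` in absolute value. [folklore] -/
theorem norm_linkGrad_le (B : SuBasis n) (f : AmbConfig d L n → ℝ) (W : AmbConfig d L n) (e : Edge d L)
    {M : ℝ} (h : ∀ a, |linkDeriv e (B.T a) f W| ≤ M) :
    ‖linkGrad B f W e‖ ≤ M * ∑ a, ‖B.T a‖ := by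
  unfold linkGrad
  refine (norm_sum_le _ _).trans ?_
  rw [Finset.mul_sum]
  refine Finset.sum_le_sum fun a _ => ?_
  rw [norm_smul, Complex.norm_real, Real.norm_eq_abs]
  exact mul_le_mul_of_nonneg_right (h a) (norm_nonneg _)

namespace GradedSeries

open Finset

variable (B : SuBasis n)

/-- **Colour gradients of the truncated β-scaled graded flow action on `SU(n)^E`**:
`|∂^a_e (∑_{k≤N} t^k β^{k+1} S̃^{(k)})(ιU)| ≤ ∑_{k≤N} |t|^k |β|^{k+1} N₀ θ₁^k` (THEOREM A termwise).
[ours] -/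
theorem abs_linkDeriv_truncFlowAction_smul_gradedSk_le (hn : n ≠ 0) (β t : ℝ) (N : ℕ)
    (U : GaugeConfig d L (Matrix.specialUnitaryGroup (Fin n) ℂ)) (e : Edge d L) (a : B.ι) :
    |linkDeriv e (B.T a)
        (truncFlowAction (fun k W => β ^ (k + 1) * gradedSk (d := d) (L := L) B k W) t N)
        (WilsonFlow.coeConfig U)|
      ≤ ∑ k ∈ Finset.range (N + 1), |t| ^ k * (|β| ^ (k + 1) * (N0 d n * theta1 d n B ^ k)) := by
  have hsm : ∀ k, ContDiff ℝ ∞ (fun W => β ^ (k + 1) * gradedSk (d := d) (L := L) B k W) :=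
    fun k => contDiff_const.mul (contDiff_gradedSk B k)
  have h := linkDeriv_finset_sum e (B.T a) (Finset.range (N + 1))
    (fun k W' => t ^ k * (β ^ (k + 1) * gradedSk (d := d) (L := L) B k W')) (fun k _ => contDiff_const.mul (hsm k))
  have h1 : linkDeriv e (B.T a)
      (truncFlowAction (fun k W => β ^ (k + 1) * gradedSk (d := d) (L := L) B k W) t N)
      (WilsonFlow.coeConfig U) =
      ∑ k ∈ Finset.range (N + 1), t ^ k * (β ^ (k + 1) *
        linkDeriv e (B.T a) (gradedSk (d := d) (L := L) B k) (WilsonFlow.coeConfig U)) := by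
    calc linkDeriv e (B.T a)
          (truncFlowAction (fun k W => β ^ (k + 1) * gradedSk (d := d) (L := L) B k W) t N)
          (WilsonFlow.coeConfig U)
        = ∑ k ∈ Finset.range (N + 1),
            linkDeriv e (B.T a) (fun W => t ^ k * (β ^ (k + 1) * gradedSk (d := d) (L := L) B k W))
              (WilsonFlow.coeConfig U) := congrFun h _
      _ = ∑ k ∈ Finset.range (N + 1), t ^ k * (β ^ (k + 1) *
            linkDeriv e (B.T a) (gradedSk (d := d) (L := L) B k) (WilsonFlow.coeConfig U)) := by
          refine Finset.sum_congr rfl fun k _ => ?_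
          rw [linkDeriv_const_mul' e (B.T a) (t ^ k) _ (WilsonFlow.coeConfig U),
            linkDeriv_const_mul' e (B.T a) (β ^ (k + 1)) _ (WilsonFlow.coeConfig U)]
  rw [h1]
  refine (Finset.abs_sum_le_sum_abs _ _).trans (Finset.sum_le_sum fun k _ => ?_)
  rw [abs_mul, abs_mul, abs_pow, abs_pow]
  exact mul_le_mul_of_nonneg_left
    (mul_le_mul_of_nonneg_left (abs_linkDeriv_gradedSk_le B hn k U e a) (pow_nonneg (abs_nonneg β) _))
    (pow_nonneg (abs_nonneg t) _)

/-- **`M_Z` — the truncated generator is bounded on the field manifold, every volume**: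
`‖∂S̃^{[N]}_{β,t}(ιU)(e)‖_F ≤ (∑_{k≤N} |t|^k |β|^{k+1} N₀ θ₁^k) · ∑ₐ ‖T^a‖_F`. [ours; cf.
Luscher2010Trivializing §3.2, §4.5(c)] -/
theorem norm_linkGrad_truncFlowAction_smul_gradedSk_le (hn : n ≠ 0) (β t : ℝ) (N : ℕ)
    (U : GaugeConfig d L (Matrix.specialUnitaryGroup (Fin n) ℂ)) (e : Edge d L) :
    ‖linkGrad B (truncFlowAction (fun k W => β ^ (k + 1) * gradedSk (d := d) (L := L) B k W) t N)
        (WilsonFlow.coeConfig U) e‖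
      ≤ (∑ k ∈ Finset.range (N + 1), |t| ^ k * (|β| ^ (k + 1) * (N0 d n * theta1 d n B ^ k))) *
          ∑ a, ‖B.T a‖ :=
  norm_linkGrad_le B _ _ e fun a => abs_linkDeriv_truncFlowAction_smul_gradedSk_le B hn β t N U e a

/-- The same bound for the generator `Z_t = -∂S̃^{[N]}_{β,t}` itself (eq. (3.6)). [ours] -/
theorem norm_neg_linkGrad_truncFlowAction_smul_gradedSk_le (hn : n ≠ 0) (β t : ℝ) (N : ℕ)
    (U : GaugeConfig d L (Matrix.specialUnitaryGroup (Fin n) ℂ)) (e : Edge d L) :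
    ‖-linkGrad B (truncFlowAction (fun k W => β ^ (k + 1) * gradedSk (d := d) (L := L) B k W) t N)
        (WilsonFlow.coeConfig U) e‖
      ≤ (∑ k ∈ Finset.range (N + 1), |t| ^ k * (|β| ^ (k + 1) * (N0 d n * theta1 d n B ^ k))) *
          ∑ a, ‖B.T a‖ := by
  rw [norm_neg]
  exact norm_linkGrad_truncFlowAction_smul_gradedSk_le B hn β t N U e

end GradedSeries

end Summit.Ventures.LatticeQCDFlow.TrivializingMaps

end
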